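import Summits.CriticalPhenomena.SAWScalingLimit.Theses.SAWFrontierHomotopy
import Summits.CriticalPhenomena.SAWScalingLimit.Theorems.SAWChargeContinuationSAWAvoidanceLawOfScalingLimit
import Summits.CriticalPhenomena.SAWScalingLimit.Theorems.SAWFrontierHomotopyOneSidedPowerLawExponentRigidity
import HarnessLib

/-!
# Crux `OneSidedPowerLaw` (stmt-CriticalPhenomena-10702), line `birth`: the crux is NECESSARY, and under the
# conjunct its exponent is exactly `5/8`

Support file (line lead c3, route SAWFrontierHomotopy; registered stub `stub_ofAvoidanceLimit`). Puts INTO THE TREE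
the necessity bridge certified earlier only in the crux workfile `Cruxes/OneSidedPowerLaw/Lines/birth_necessity.lean`
(lead c1), and combines it with the exponent rigidity of `…ExponentRigidity` (lead c3):

* `stub_ofAvoidanceLimit` — `AvoidanceLimit → (body of OneSidedPowerLaw at α = 5/8)`: the closed-range avoidance crux
  of route SAWLoopFugacityFlow (stmt-CriticalPhenomena-4981; two-sided hulls, value `Φ'_A(0)^{5/8}`) gives the one-sided
  power law with `α = 5/8` — the crux's five hull-subdomain clauses ARE `MarkedDomain.IsHullSubdomain` (definitionally),
  whence the ball clause of `AvoidanceLimit` (`exists_ball_inter_eq`); one-sidedness is simply dropped;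
* `oneSidedPowerLaw_of_avoidanceLimit`, `oneSidedPowerLaw_of_sawScalingLimit` (via the tree's
  `SAWChargeContinuation.avoidanceLimit_of_sawScalingLimit`), `not_sawScalingLimit_of_not_oneSidedPowerLaw`: the crux is a
  genuine waypoint — refuting it refutes the conjunct `SAWScalingLimit` as typed;
* `OneSidedPowerLawExp.eq_five_eighths_of_avoidanceLimit` / `_of_sawScalingLimit`: by uniqueness of the exponent
  (`OneSidedPowerLawExp.unique`), under `AvoidanceLimit` (a fortiori under the conjunct) the ONLY admissible exponent of
  the crux is `5/8`, and `OneSidedPowerLaw ↔ OneSidedPowerLawExp (5/8)`.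

No definition and no named fact is introduced. Sources: LawlerSchrammWerner2003Restriction Thm. 6.1;
LawlerSchrammWerner2004SAW §4.1 Prediction 1; folklore.
-/

noncomputable section

open scoped Topology ENNReal NNReal
open Filter Set MeasureTheory
open UpperHalfPlane (upperHalfPlaneSet)
open Literature.Probability.RandomPlanarGeometry Literature.Probability.LatticeModels
open Summit.CriticalPhenomena.SAWScalingLimit.Theses.SAWFrontierHomotopy (OneSidedPowerLaw)
open Summit.CriticalPhenomena.SAWScalingLimit.Theses.SAWLoopFugacityFlow (AvoidanceLimit)

namespace Summit.CriticalPhenomena.SAWScalingLimit.Theorems.OneSidedPowerLaw.Negative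

/-- **Registered stub `stub_ofAvoidanceLimit`** (definition-free): `AvoidanceLimit` implies the body of the crux
`OneSidedPowerLaw` at the exponent `5/8` (hull clauses = `IsHullSubdomain` definitionally ⇒ ball clause by
`exists_ball_inter_eq`; the one-sidedness hypothesis is dropped). [cite: LawlerSchrammWerner2004SAW, §4.1 Prediction 1] -/
theorem stub_ofAvoidanceLimit : AvoidanceLimit →
    (∀ (D : DobrushinDomain) (a b : ℝ → Site 2), SAW.IsEndpointApprox D a b →
      ∀ (D' : DobrushinDomain), (D'.carrier ⊆ D.carrier ∧ D'.pt 0 = D.pt 0 ∧ D'.pt 1 = D.pt 1 ∧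
        D.pt 0 ∉ closure (D.carrier \ D'.carrier) ∧ D.pt 1 ∉ closure (D.carrier \ D'.carrier)) →
      ∀ (φ : ConformalEquiv upperHalfPlaneSet D.carrier), D.IsChordalUniformizing φ →
      (IsPlusHull (closure (upperHalfPlaneSet \ {z : ℂ | z ∈ upperHalfPlaneSet ∧ φ z ∈ D'.carrier})) ∨
        IsMinusHull (closure (upperHalfPlaneSet \ {z : ℂ | z ∈ upperHalfPlaneSet ∧ φ z ∈ D'.carrier}))) →
      ∀ (Φ : ConformalEquiv (upperHalfPlaneSet \ closure (upperHalfPlaneSet \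
          {z : ℂ | z ∈ upperHalfPlaneSet ∧ φ z ∈ D'.carrier})) upperHalfPlaneSet) (d : ℝ),
        IsRestrictionMap (closure (upperHalfPlaneSet \ {z : ℂ | z ∈ upperHalfPlaneSet ∧ φ z ∈ D'.carrier})) Φ →
        HasRestrictionDeriv (closure (upperHalfPlaneSet \ {z : ℂ | z ∈ upperHalfPlaneSet ∧ φ z ∈ D'.carrier})) Φ d →
        Tendsto (fun δ => ((SAW.law D.carrier δ (a δ) (b δ)).map (fun γ => γ.curve))
          (CurveClass.rangeSubset (closure D'.carrier))) (𝓝[>] 0) (𝓝 (ENNReal.ofReal (d ^ ((5 : ℝ) / 8))))) := by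
  intro h D a b hab D' hsub φ hφ _ Φ d hΦ hd
  have hHull : D.IsHullSubdomain D' := hsub
  exact h D D' a b hab hHull.carrier_subset hHull.pt_zero_eq hHull.pt_one_eq
    (Theorems.SimpleSubseqLimits.MarkedPointRevisit.ArcRangeBoundary.exists_ball_inter_eq hHull)
    φ hφ _ rfl Φ d hΦ hd

/-- `AvoidanceLimit → OneSidedPowerLawExp (5/8)` (the registered stub, by `Iff.rfl`). [folklore] -/
theorem oneSidedPowerLawExp_of_avoidanceLimit (h : AvoidanceLimit) : OneSidedPowerLawExp ((5 : ℝ) / 8) :=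
  stub_ofAvoidanceLimit h

/-- **`AvoidanceLimit → OneSidedPowerLaw`** (with `α = 5/8`): the crux is formally below the closed-range avoidance
crux of route SAWLoopFugacityFlow (stmt-CriticalPhenomena-4981). [cite: LawlerSchrammWerner2004SAW, §4.1 Prediction 1] -/
theorem oneSidedPowerLaw_of_avoidanceLimit (h : AvoidanceLimit) : OneSidedPowerLaw :=
  ⟨(5 : ℝ) / 8, stub_ofAvoidanceLimit h⟩

/-- **`SAWScalingLimit → OneSidedPowerLaw`: the crux is necessary for the sub-problem**, through the tree's
`SAWChargeContinuation.avoidanceLimit_of_sawScalingLimit` ([LSW] Thm. 6.1 for the limit law, portmanteau sandwich,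
null touching event). [cite: LawlerSchrammWerner2003Restriction, Thm. 6.1 (p. 23)] -/
theorem oneSidedPowerLaw_of_sawScalingLimit (hS : _root_.SAWScalingLimit) : OneSidedPowerLaw :=
  oneSidedPowerLaw_of_avoidanceLimit (Theorems.SAWChargeContinuation.avoidanceLimit_of_sawScalingLimit hS)

/-- Contrapositive, the disprover's form: **a refutation of the crux refutes the conjunct as typed.** [folklore] -/
theorem not_sawScalingLimit_of_not_oneSidedPowerLaw (h : ¬ OneSidedPowerLaw) : ¬ _root_.SAWScalingLimit :=
  fun hS ↦ h (oneSidedPowerLaw_of_sawScalingLimit hS)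

/-- **Under `AvoidanceLimit` the only admissible exponent of the crux is `5/8`** (uniqueness of the exponent,
`OneSidedPowerLawExp.unique`). [folklore] -/
theorem OneSidedPowerLawExp.eq_five_eighths_of_avoidanceLimit (h : AvoidanceLimit) {α : ℝ}
    (hα : OneSidedPowerLawExp α) : α = (5 : ℝ) / 8 :=
  hα.unique (oneSidedPowerLawExp_of_avoidanceLimit h)

/-- **Under the conjunct `SAWScalingLimit` the only admissible exponent of the crux is `5/8`.** [folklore] -/
theorem OneSidedPowerLawExp.eq_five_eighths_of_sawScalingLimit (hS : _root_.SAWScalingLimit) {α : ℝ}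
    (hα : OneSidedPowerLawExp α) : α = (5 : ℝ) / 8 :=
  hα.eq_five_eighths_of_avoidanceLimit (Theorems.SAWChargeContinuation.avoidanceLimit_of_sawScalingLimit hS)

/-- Under `AvoidanceLimit`, the crux is equivalent to its `α = 5/8` instance. [folklore] -/
theorem oneSidedPowerLaw_iff_exp_five_eighths_of_avoidanceLimit (h : AvoidanceLimit) :
    OneSidedPowerLaw ↔ OneSidedPowerLawExp ((5 : ℝ) / 8) :=
  ⟨fun _ ↦ oneSidedPowerLawExp_of_avoidanceLimit h, fun h58 ↦ ⟨_, h58⟩⟩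

/-- Under `AvoidanceLimit`, every exponent other than `5/8` is refuted for the crux body (e.g. the
Brownian-excursion value `1`, the Ising value `1/2`). [folklore] -/
theorem not_oneSidedPowerLawExp_of_avoidanceLimit (h : AvoidanceLimit) {α : ℝ} (hα : α ≠ (5 : ℝ) / 8) :
    ¬ OneSidedPowerLawExp α :=
  fun hα' ↦ hα (hα'.eq_five_eighths_of_avoidanceLimit h)

end Summit.CriticalPhenomena.SAWScalingLimit.Theorems.OneSidedPowerLaw.Negative

end
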